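import Summits.AtomisticToContinuum.HydrodynamicLimit.Theorems.JParityClosureParityBandClosureWindowCovarianceIsotropyE
import HarnessLib

/-!
# Window covariance isotropy (crux `JParityClosure.ParityBandClosure`, stmt-AtomisticToContinuum-17608, line
# `transfer-weighted-parity-chain`, stub `stub_windowCovarianceIsotropy`) — helper F: the window functionals as
# named definitions, and their measurability in the window

WHAT.  §1 The window functionals of the three statements involved, as definitions over a configuration path `γ`
that are DEFINITIONALLY the `let`-towers of the statements once `γ := fun s => (Φ N).flow s z` (so that the final
assembly converts hypotheses and goal by `exact`): the window density / momentum / second moments / covariance /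
deviator `rhoW, mwW, EwW, CwW, devW` of `WindowCovarianceIsotropy`; the window KDE `hwW`, the incoming pair `pvW` and
the Metropolis-odd collision functional `KwO` of `OddContactSymmetryPW`; the two-time reference functional `BwW` and the
marked collision functional `KwR` of `RateFloorPW`.  §2 Their dictionary with helpers A–C (`rhoW` = mass of the window
law, `mwW`/`EwW` = its first/second moments, `KwO`/`KwR` in `collisionPairSum` form).  §3 Joint measurability in the
window `(t₀, x₀) ∈ ℝ × 𝕋³` of every functional along a hard-sphere trajectory (parametric integrals of jointly
measurable integrands, `StronglyMeasurable.integral_prod_right'`; finite collision sums).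

REFERENCES.  H. Spohn, *Large Scale Dynamics of Interacting Particles* (1991), Part I §3; elementary measure theory.
No named fact is invoked.
-/

noncomputable section

namespace Summit.AtomisticToContinuum.HydrodynamicLimit.Theorems.ParityBandClosureWindowCovariance

open scoped BigOperators Topology Classical MeasureTheory ENNReal InnerProductSpace
open Filter Set MeasureTheory Function Topology
open Literature.MathematicalPhysics.KineticTheory
open Literature.Analysis.FluidPDE
open Summit.AtomisticToContinuum.HydrodynamicLimit.Theorems.LocalSecondLawNegative (cone cone_nonneg cone_le
  continuous_cone integral_cone_le)

variable {N : ℕ}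

/-! ## §1 The window functionals -/

/-- Window density `ρ_w(t₀, x₀) = ∫ btent(s − t₀) ρ_r(γ s, x₀) ds`. [folklore] -/
def rhoW (r τ : ℝ) (γ : ℝ → Config (N + 1) (Fin 3) T3) (t₀ : ℝ) (x₀ : T3) : ℝ :=
  ∫ s in Set.Icc (0 : ℝ) τ, btent r (s - t₀) * ∫ q, cone r q.1 x₀ ∂(empiricalMeasure (γ s))

/-- Window momentum `m_w(t₀, x₀)_j`. [folklore] -/
def mwW (r τ : ℝ) (γ : ℝ → Config (N + 1) (Fin 3) T3) (t₀ : ℝ) (x₀ : T3) (j : Fin 3) : ℝ :=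
  ∫ s in Set.Icc (0 : ℝ) τ, btent r (s - t₀) * ∫ q, cone r q.1 x₀ * q.2 j ∂(empiricalMeasure (γ s))

/-- Window second moments `E_w(t₀, x₀)_{jk}`. [folklore] -/
def EwW (r τ : ℝ) (γ : ℝ → Config (N + 1) (Fin 3) T3) (t₀ : ℝ) (x₀ : T3) (j k : Fin 3) : ℝ :=
  ∫ s in Set.Icc (0 : ℝ) τ, btent r (s - t₀) * ∫ q, cone r q.1 x₀ * (q.2 j * q.2 k) ∂(empiricalMeasure (γ s))

/-- Window covariance `C_w = E_w − m_w ⊗ m_w/ρ_w` (Lean `x/0 = 0`). [folklore] -/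
def CwW (r τ : ℝ) (γ : ℝ → Config (N + 1) (Fin 3) T3) (t₀ : ℝ) (x₀ : T3) (j k : Fin 3) : ℝ :=
  EwW r τ γ t₀ x₀ j k - mwW r τ γ t₀ x₀ j * mwW r τ γ t₀ x₀ k / rhoW r τ γ t₀ x₀

/-- The `ℓ¹` deviator of the window covariance. [folklore] -/
def devW (r τ : ℝ) (γ : ℝ → Config (N + 1) (Fin 3) T3) (t₀ : ℝ) (x₀ : T3) : ℝ :=
  ∑ j : Fin 3, ∑ k : Fin 3, |CwW r τ γ t₀ x₀ j k - if j = k then (∑ l : Fin 3, CwW r τ γ t₀ x₀ l l) / 3 else 0|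

/-- Window KDE `hw(t₀, x₀, v) = ∫ btent ∫ cone · G_{ϑ²}(v − ·) dμ ds` at bandwidth `ϑ`. [folklore] -/
def hwW (r τ ϑ : ℝ) (γ : ℝ → Config (N + 1) (Fin 3) T3) (t₀ : ℝ) (x₀ : T3) (v : V3) : ℝ :=
  ∫ s in Set.Icc (0 : ℝ) τ, btent r (s - t₀) *
    ∫ q, cone r q.1 x₀ * localMaxwellian 1 (ϑ ^ 2) v q.2 ∂(empiricalMeasure (γ s))

/-- Incoming pair of the ordered pair `(i, j)` of a (post-collisional) configuration. [folklore] -/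
def pvW (w : Config (N + 1) (Fin 3) T3) (i j : Fin (N + 1)) : V3 × V3 :=
  reflectVel ((Torus.geometry (Fin 3)).sepVec (w i).1 (w j).1) ((w i).2, (w j).2)

/-- The Metropolis-odd window collision functional `K_w` of `OddContactSymmetryPW` (inline form). [folklore] -/
def KwO (ε r τ ϑ : ℝ) (Ψ : V3 × V3 × V3 → ℝ) (γ : ℝ → Config (N + 1) (Fin 3) T3) (t₀ : ℝ) (x₀ : T3) : ℝ :=
  ε / (N + 1 : ℝ) * ∑ᶠ (s : ℝ) (_ : s ∈ collisionTimes (Torus.geometry (Fin 3)) ε γ ∩ Set.Icc 0 τ),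
    ∑ i : Fin (N + 1), ∑ j : Fin (N + 1),
      (if i ≠ j ∧ ‖(Torus.geometry (Fin 3)).sepVec (γ s i).1 (γ s j).1‖ = ε then
        btent r (s - t₀) * cone r (γ s i).1 x₀ *
          (Ψ (ε⁻¹ • (Torus.geometry (Fin 3)).sepVec (γ s i).1 (γ s j).1, (pvW (γ s) i j).1, (pvW (γ s) i j).2) *
            min 1 (Real.exp (-(Real.log (hwW r τ ϑ γ t₀ x₀ (pvW (γ s) i j).1) +
              Real.log (hwW r τ ϑ γ t₀ x₀ (pvW (γ s) i j).2) -
              Real.log (hwW r τ ϑ γ t₀ x₀ (γ s i).2) - Real.log (hwW r τ ϑ γ t₀ x₀ (γ s j).2))))) else 0)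

/-- The two-time reference functional `B_w` of `RateFloorPW` (`Θ = sphereMark Ξ`). [folklore] -/
def BwW (r τ : ℝ) (Ξ : V3 × V3 × V3 → ℝ) (γ : ℝ → Config (N + 1) (Fin 3) T3) (t₀ : ℝ) (x₀ : T3) : ℝ :=
  ∫ s₁ in Set.Icc (0 : ℝ) τ, ∫ s₂ in Set.Icc (0 : ℝ) τ, btent r (s₁ - t₀) * btent r (s₂ - t₀) *
    ∫ p, cone r p.1.1 x₀ * cone r p.2.1 x₀ * sphereMark Ξ p.1.2 p.2.2
      ∂((empiricalMeasure (γ s₁)).prod (empiricalMeasure (γ s₂)))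

/-- The marked window collision functional `K_w` of `RateFloorPW` (inline form). [folklore] -/
def KwR (ε r τ : ℝ) (Ξ : V3 × V3 × V3 → ℝ) (γ : ℝ → Config (N + 1) (Fin 3) T3) (t₀ : ℝ) (x₀ : T3) : ℝ :=
  ε / (N + 1 : ℝ) * ∑ᶠ (s : ℝ) (_ : s ∈ collisionTimes (Torus.geometry (Fin 3)) ε γ ∩ Set.Icc 0 τ),
    ∑ i : Fin (N + 1), ∑ j : Fin (N + 1),
      (if i ≠ j ∧ ‖(Torus.geometry (Fin 3)).sepVec (γ s i).1 (γ s j).1‖ = ε then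
        btent r (s - t₀) * cone r (γ s i).1 x₀ *
          Ξ (ε⁻¹ • (Torus.geometry (Fin 3)).sepVec (γ s i).1 (γ s j).1, (pvW (γ s) i j).1, (pvW (γ s) i j).2)
      else 0)

/-! ## §2 Dictionary with the window law and the window record -/

section Dict

variable {ε r τ t₀ : ℝ} {x₀ : T3} {γ : ℝ → Config (N + 1) (Fin 3) T3}

/-- `ρ_w` is the mass of the window law. [folklore] -/
theorem rhoW_eq_mass (hr : 0 < r) (hγ : Measurable γ) : rhoW r τ γ t₀ x₀ = ((wlaw r τ t₀ x₀ γ) Set.univ).toReal :=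
  (wlaw_univ_toReal hr hγ).symm

/-- `ρ_w ≥ 0`. [folklore] -/
theorem rhoW_nonneg (hr : 0 < r) (hγ : Measurable γ) : 0 ≤ rhoW r τ γ t₀ x₀ := by
  rw [rhoW_eq_mass hr hγ]; exact ENNReal.toReal_nonneg

/-- A coordinate of `ℝ³` is measurable. [folklore] -/
theorem measurable_coordV3 (j : Fin 3) : Measurable fun v : V3 => v j := by fun_prop

/-- `m_w` is the first moment of the window law. [folklore] -/
theorem mwW_eq_integral (hr : 0 < r) (hγ : Measurable γ) {R : ℝ} (hR : ∀ s k, ‖(γ s k).2‖ ≤ R) (j : Fin 3) :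
    mwW r τ γ t₀ x₀ j = ∫ v, v j ∂(wlaw r τ t₀ x₀ γ) := by
  have hc : ∀ (v : V3) (i : Fin 3), |v i| ≤ ‖v‖ := fun v i => by
    rw [← Real.norm_eq_abs]; exact PiLp.norm_apply_le v i
  have h := integral_wlaw (τ := τ) (t₀ := t₀) (x₀ := x₀) hr hγ (f := fun v : V3 => v j) (measurable_coordV3 j)
    (C := R) (fun s k => (hc (γ s k).2 j).trans (hR s k))
  exact h.symm

/-- `E_w` is the second moment of the window law. [folklore] -/
theorem EwW_eq_integral (hr : 0 < r) (hγ : Measurable γ) {R : ℝ} (hR : ∀ s k, ‖(γ s k).2‖ ≤ R) (j k : Fin 3) :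
    EwW r τ γ t₀ x₀ j k = ∫ v, v j * v k ∂(wlaw r τ t₀ x₀ γ) := by
  have hc : ∀ (v : V3) (i : Fin 3), |v i| ≤ ‖v‖ := fun v i => by
    rw [← Real.norm_eq_abs]; exact PiLp.norm_apply_le v i
  have h := integral_wlaw (τ := τ) (t₀ := t₀) (x₀ := x₀) hr hγ (f := fun v : V3 => v j * v k)
    ((measurable_coordV3 j).mul (measurable_coordV3 k)) (C := R * R) (fun s l => by
      rw [abs_mul]
      exact mul_le_mul ((hc _ j).trans (hR s l)) ((hc _ k).trans (hR s l))
        (abs_nonneg _) ((norm_nonneg _).trans (hR s l)))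
  exact h.symm

/-- The odd window functional in `collisionPairSum` form. [folklore] -/
theorem KwO_eq (hγ : IsHardSphereTrajectory (Torus.geometry (Fin 3)) ε (N + 1) γ) (ϑ : ℝ) (Ψ : V3 × V3 × V3 → ℝ) :
    KwO ε r τ ϑ Ψ γ t₀ x₀ = ε / (N + 1 : ℝ) * collisionPairSum (Torus.geometry (Fin 3)) ε γ (Set.Icc 0 τ)
      (fun s i j => btent r (s - t₀) * cone r (γ s i).1 x₀ *
        (Ψ (ε⁻¹ • (Torus.geometry (Fin 3)).sepVec (γ s i).1 (γ s j).1, (pvW (γ s) i j).1, (pvW (γ s) i j).2) *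
          min 1 (Real.exp (-(Real.log (hwW r τ ϑ γ t₀ x₀ (pvW (γ s) i j).1) +
            Real.log (hwW r τ ϑ γ t₀ x₀ (pvW (γ s) i j).2) -
            Real.log (hwW r τ ϑ γ t₀ x₀ (γ s i).2) - Real.log (hwW r τ ϑ γ t₀ x₀ (γ s j).2)))))) := by
  unfold KwO
  rw [collisionPairSum_eq_finsum_ite hγ.mem]

/-- The marked window functional in `collisionPairSum` form. [folklore] -/
theorem KwR_eq (hγ : IsHardSphereTrajectory (Torus.geometry (Fin 3)) ε (N + 1) γ) (Ξ : V3 × V3 × V3 → ℝ) :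
    KwR ε r τ Ξ γ t₀ x₀ = ε / (N + 1 : ℝ) * collisionPairSum (Torus.geometry (Fin 3)) ε γ (Set.Icc 0 τ)
      (fun s i j => btent r (s - t₀) * cone r (γ s i).1 x₀ *
        Ξ (ε⁻¹ • (Torus.geometry (Fin 3)).sepVec (γ s i).1 (γ s j).1, (pvW (γ s) i j).1, (pvW (γ s) i j).2)) := by
  unfold KwR
  rw [collisionPairSum_eq_finsum_ite hγ.mem]

end Dict

/-! ## §3 Measurability in the window -/

section Meas

variable {ε r τ : ℝ} {γ : ℝ → Config (N + 1) (Fin 3) T3}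

/-- **Law-type window functionals are jointly measurable in the window**: for a measurable velocity test `ψ`,
`(t₀, x₀) ↦ ∫ btent(s − t₀) ∫ cone(q.1, x₀) ψ(q.2) dμ_{γ s} ds`. [folklore] -/
theorem measurable_lawFun (hγ : Measurable γ) (r τ : ℝ) {ψ : V3 → ℝ} (hψ : Measurable ψ) :
    Measurable fun p : ℝ × T3 => ∫ s in Set.Icc (0 : ℝ) τ, btent r (s - p.1) *
      ∫ q, cone r q.1 p.2 * ψ q.2 ∂(empiricalMeasure (γ s)) := by
  have hvk : ∀ k : Fin (N + 1), Measurable fun s : ℝ => (γ s k).2 := fun k => ((measurable_pi_apply k).comp hγ).snd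
  have hxk : ∀ k : Fin (N + 1), Measurable fun s : ℝ => (γ s k).1 := fun k => ((measurable_pi_apply k).comp hγ).fst
  have hfun : (fun p : ℝ × T3 => ∫ s in Set.Icc (0 : ℝ) τ, btent r (s - p.1) *
      ∫ q, cone r q.1 p.2 * ψ q.2 ∂(empiricalMeasure (γ s))) =
      fun p : ℝ × T3 => ∫ s in Set.Icc (0 : ℝ) τ, btent r (s - p.1) *
        (((N + 1 : ℕ) : ℝ)⁻¹ * ∑ k, cone r (γ s k).1 p.2 * ψ (γ s k).2) := by
    funext p
    refine integral_congr_ae (Eventually.of_forall fun s => ?_)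
    show btent r (s - p.1) * ∫ q, cone r q.1 p.2 * ψ q.2 ∂(empiricalMeasure (γ s)) = _
    rw [integral_empiricalMeasure]
  rw [hfun]
  have hjm : Measurable fun q : (ℝ × T3) × ℝ => btent r (q.2 - q.1.1) *
      (((N + 1 : ℕ) : ℝ)⁻¹ * ∑ k, cone r (γ q.2 k).1 q.1.2 * ψ (γ q.2 k).2) := by
    have h1 : Measurable fun q : (ℝ × T3) × ℝ => btent r (q.2 - q.1.1) :=
      (continuous_btent r).measurable.comp (measurable_snd.sub measurable_fst.fst)
    refine h1.mul (measurable_const.mul (Finset.measurable_sum _ fun k _ => ?_))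
    have h2 : Measurable fun q : (ℝ × T3) × ℝ => cone r (γ q.2 k).1 q.1.2 :=
      measurable_cone_comp r ((hxk k).comp measurable_snd) measurable_fst.snd
    have h3 : Measurable fun q : (ℝ × T3) × ℝ => ψ (γ q.2 k).2 := hψ.comp ((hvk k).comp measurable_snd)
    exact h2.mul h3
  have h := (hjm.stronglyMeasurable.integral_prod_right' (ν := volume.restrict (Set.Icc (0 : ℝ) τ))).measurable
  exact h

/-- `ρ_w` is jointly measurable in the window. [folklore] -/
theorem measurable_rhoW (hγ : Measurable γ) (r τ : ℝ) :
    Measurable fun p : ℝ × T3 => rhoW r τ γ p.1 p.2 := by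
  have h := measurable_lawFun hγ r τ (ψ := fun _ : V3 => (1 : ℝ)) measurable_const
  simp only [mul_one] at h
  exact h

/-- `m_w` is jointly measurable in the window. [folklore] -/
theorem measurable_mwW (hγ : Measurable γ) (r τ : ℝ) (j : Fin 3) :
    Measurable fun p : ℝ × T3 => mwW r τ γ p.1 p.2 j := by
  have h := measurable_lawFun hγ r τ (ψ := fun v : V3 => v j) (measurable_coordV3 j)
  exact h

/-- `E_w` is jointly measurable in the window. [folklore] -/
theorem measurable_EwW (hγ : Measurable γ) (r τ : ℝ) (j k : Fin 3) :
    Measurable fun p : ℝ × T3 => EwW r τ γ p.1 p.2 j k := by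
  have h := measurable_lawFun hγ r τ (ψ := fun v : V3 => v j * v k) ((measurable_coordV3 j).mul (measurable_coordV3 k))
  exact h

/-- The window KDE is jointly measurable in the window, at every velocity. [folklore] -/
theorem measurable_hwW (hγ : Measurable γ) (r τ ϑ : ℝ) (v : V3) :
    Measurable fun p : ℝ × T3 => hwW r τ ϑ γ p.1 p.2 v := by
  have h := measurable_lawFun hγ r τ (ψ := fun v' : V3 => localMaxwellian 1 (ϑ ^ 2) v v')
    (continuous_localMaxwellian 1 (ϑ ^ 2) v).measurable
  exact h

/-- `C_w` and the deviator are jointly measurable in the window. [folklore] -/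
theorem measurable_devW (hγ : Measurable γ) (r τ : ℝ) :
    Measurable fun p : ℝ × T3 => devW r τ γ p.1 p.2 := by
  have hC : ∀ j k, Measurable fun p : ℝ × T3 => CwW r τ γ p.1 p.2 j k := fun j k =>
    (measurable_EwW hγ r τ j k).sub (((measurable_mwW hγ r τ j).mul (measurable_mwW hγ r τ k)).div
      (measurable_rhoW hγ r τ))
  unfold devW
  refine Finset.measurable_sum _ fun j _ => Finset.measurable_sum _ fun k _ => ?_
  refine ((hC j k).sub ?_).abs
  by_cases hjk : j = k
  · simp only [hjk, if_true]
    exact (Finset.measurable_sum _ fun l _ => hC l l).div_const _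
  · simp only [hjk, if_false]
    exact measurable_const

/-- **Record-type window functionals are jointly measurable in the window** when the marks are. [folklore] -/
theorem measurable_recFun (hfin : (collisionTimes (Torus.geometry (Fin 3)) ε γ ∩ Set.Icc 0 τ).Finite) (r : ℝ)
    {m : ℝ × T3 → ℝ → Fin (N + 1) → Fin (N + 1) → ℝ} (hm : ∀ s i j, Measurable fun p => m p s i j) :
    Measurable fun p : ℝ × T3 => collisionPairSum (Torus.geometry (Fin 3)) ε γ (Set.Icc 0 τ)
      (fun s i j => btent r (s - p.1) * cone r (γ s i).1 p.2 * m p s i j) := by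
  have hfun : (fun p : ℝ × T3 => collisionPairSum (Torus.geometry (Fin 3)) ε γ (Set.Icc 0 τ)
      (fun s i j => btent r (s - p.1) * cone r (γ s i).1 p.2 * m p s i j)) =
      fun p => ∑ t ∈ hfin.toFinset, ∑ q ∈ contactPairs (Torus.geometry (Fin 3)) ε (γ t),
        btent r (t - p.1) * cone r (γ t q.1).1 p.2 * m p t q.1 q.2 := by
    funext p
    exact collisionPairSum_eq_finset_sum hfin _
  rw [hfun]
  refine Finset.measurable_sum _ fun t _ => Finset.measurable_sum _ fun q _ => ?_
  have h1 : Measurable fun p : ℝ × T3 => btent r (t - p.1) :=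
    (continuous_btent r).measurable.comp (measurable_const.sub measurable_fst)
  have h2 : Measurable fun p : ℝ × T3 => cone r (γ t q.1).1 p.2 := measurable_cone_comp r measurable_const measurable_snd
  exact (h1.mul h2).mul (hm t q.1 q.2)

/-- The odd window functional is jointly measurable in the window. [folklore] -/
theorem measurable_KwO (hγ : IsHardSphereTrajectory (Torus.geometry (Fin 3)) ε (N + 1) γ) (r τ ϑ : ℝ)
    {Ψ : V3 × V3 × V3 → ℝ} :
    Measurable fun p : ℝ × T3 => KwO ε r τ ϑ Ψ γ p.1 p.2 := by
  have hfun : (fun p : ℝ × T3 => KwO ε r τ ϑ Ψ γ p.1 p.2) = fun p => ε / (N + 1 : ℝ) *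
      collisionPairSum (Torus.geometry (Fin 3)) ε γ (Set.Icc 0 τ)
      (fun s i j => btent r (s - p.1) * cone r (γ s i).1 p.2 *
        (Ψ (ε⁻¹ • (Torus.geometry (Fin 3)).sepVec (γ s i).1 (γ s j).1, (pvW (γ s) i j).1, (pvW (γ s) i j).2) *
          min 1 (Real.exp (-(Real.log (hwW r τ ϑ γ p.1 p.2 (pvW (γ s) i j).1) +
            Real.log (hwW r τ ϑ γ p.1 p.2 (pvW (γ s) i j).2) -
            Real.log (hwW r τ ϑ γ p.1 p.2 (γ s i).2) - Real.log (hwW r τ ϑ γ p.1 p.2 (γ s j).2)))))) := by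
    funext p; exact KwO_eq hγ ϑ Ψ
  rw [hfun]
  refine measurable_const.mul (measurable_recFun (finite_collisionTimes_Icc hγ τ) r fun s i j => ?_)
  have hl : ∀ a : V3, Measurable fun p : ℝ × T3 => Real.log (hwW r τ ϑ γ p.1 p.2 a) := fun a =>
    Real.measurable_log.comp (measurable_hwW hγ.measurable_torus r τ ϑ a)
  refine measurable_const.mul (measurable_const.min (Real.measurable_exp.comp ?_))
  exact (((hl _).add (hl _)).sub (hl _)).sub (hl _) |>.neg

/-- The marked window functional is jointly measurable in the window. [folklore] -/
theorem measurable_KwR (hγ : IsHardSphereTrajectory (Torus.geometry (Fin 3)) ε (N + 1) γ) (r τ : ℝ)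
    {Ξ : V3 × V3 × V3 → ℝ} :
    Measurable fun p : ℝ × T3 => KwR ε r τ Ξ γ p.1 p.2 := by
  have hfun : (fun p : ℝ × T3 => KwR ε r τ Ξ γ p.1 p.2) = fun p => ε / (N + 1 : ℝ) *
      collisionPairSum (Torus.geometry (Fin 3)) ε γ (Set.Icc 0 τ)
      (fun s i j => btent r (s - p.1) * cone r (γ s i).1 p.2 *
        Ξ (ε⁻¹ • (Torus.geometry (Fin 3)).sepVec (γ s i).1 (γ s j).1, (pvW (γ s) i j).1, (pvW (γ s) i j).2)) := by
    funext p; exact KwR_eq hγ Ξ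
  rw [hfun]
  exact measurable_const.mul (measurable_recFun (finite_collisionTimes_Icc hγ τ) r fun s i j => measurable_const)

/-- The two-time reference functional is jointly measurable in the window (continuous mark). [folklore] -/
theorem measurable_BwW (hγ : IsHardSphereTrajectory (Torus.geometry (Fin 3)) ε (N + 1) γ) (r τ : ℝ)
    {Ξ : V3 × V3 × V3 → ℝ} (hΞ : Continuous Ξ) :
    Measurable fun p : ℝ × T3 => BwW r τ Ξ γ p.1 p.2 := by
  have hγm := hγ.measurable_torus
  have hvk : ∀ k : Fin (N + 1), Measurable fun s : ℝ => (γ s k).2 := fun k => ((measurable_pi_apply k).comp hγm).snd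
  have hxk : ∀ k : Fin (N + 1), Measurable fun s : ℝ => (γ s k).1 := fun k => ((measurable_pi_apply k).comp hγm).fst
  have hΘ : Measurable fun p : V3 × V3 => sphereMark Ξ p.1 p.2 := (continuous_sphereMark_uncurry hΞ).measurable
  -- the integrand as a jointly measurable function of `((p, s₁), s₂)`
  set f : ((ℝ × T3) × ℝ) × ℝ → ℝ := fun q => btent r (q.1.2 - q.1.1.1) * btent r (q.2 - q.1.1.1) *
    (((N + 1 : ℕ) : ℝ)⁻¹ * ((N + 1 : ℕ) : ℝ)⁻¹ *
      ∑ i, ∑ k, cone r (γ q.1.2 i).1 q.1.1.2 * cone r (γ q.2 k).1 q.1.1.2 * sphereMark Ξ (γ q.1.2 i).2 (γ q.2 k).2)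
    with hfdef
  have hf : Measurable f := by
    have h1 : Measurable fun q : ((ℝ × T3) × ℝ) × ℝ => btent r (q.1.2 - q.1.1.1) :=
      (continuous_btent r).measurable.comp (measurable_fst.snd.sub measurable_fst.fst.fst)
    have h2 : Measurable fun q : ((ℝ × T3) × ℝ) × ℝ => btent r (q.2 - q.1.1.1) :=
      (continuous_btent r).measurable.comp (measurable_snd.sub measurable_fst.fst.fst)
    refine (h1.mul h2).mul (measurable_const.mul (Finset.measurable_sum _ fun i _ =>
      Finset.measurable_sum _ fun k _ => ?_))
    have h3 : Measurable fun q : ((ℝ × T3) × ℝ) × ℝ => cone r (γ q.1.2 i).1 q.1.1.2 :=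
      measurable_cone_comp r ((hxk i).comp measurable_fst.snd) measurable_fst.fst.snd
    have h4 : Measurable fun q : ((ℝ × T3) × ℝ) × ℝ => cone r (γ q.2 k).1 q.1.1.2 :=
      measurable_cone_comp r ((hxk k).comp measurable_snd) measurable_fst.fst.snd
    have h5 : Measurable fun q : ((ℝ × T3) × ℝ) × ℝ => sphereMark Ξ (γ q.1.2 i).2 (γ q.2 k).2 :=
      hΘ.comp (((hvk i).comp measurable_fst.snd).prodMk ((hvk k).comp measurable_snd))
    exact (h3.mul h4).mul h5
  have hinner : Measurable fun q : (ℝ × T3) × ℝ => ∫ s₂ in Set.Icc (0 : ℝ) τ, f (q, s₂) := by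
    have h := (hf.stronglyMeasurable.integral_prod_right' (ν := volume.restrict (Set.Icc (0 : ℝ) τ))).measurable
    exact h
  have houter : Measurable fun p : ℝ × T3 => ∫ s₁ in Set.Icc (0 : ℝ) τ, ∫ s₂ in Set.Icc (0 : ℝ) τ, f ((p, s₁), s₂) := by
    have h := ((hinner.comp (measurable_id : Measurable fun q : (ℝ × T3) × ℝ => q)).stronglyMeasurable.integral_prod_right'
      (ν := volume.restrict (Set.Icc (0 : ℝ) τ))).measurable
    exact h
  have hfun : (fun p : ℝ × T3 => BwW r τ Ξ γ p.1 p.2) =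
      fun p => ∫ s₁ in Set.Icc (0 : ℝ) τ, ∫ s₂ in Set.Icc (0 : ℝ) τ, f ((p, s₁), s₂) := by
    funext p
    unfold BwW
    refine integral_congr_ae (Eventually.of_forall fun s₁ => integral_congr_ae (Eventually.of_forall fun s₂ => ?_))
    show btent r (s₁ - p.1) * btent r (s₂ - p.1) *
      ∫ q, cone r q.1.1 p.2 * cone r q.2.1 p.2 * sphereMark Ξ q.1.2 q.2.2
        ∂((empiricalMeasure (γ s₁)).prod (empiricalMeasure (γ s₂))) = f ((p, s₁), s₂)
    rw [integral_prod_empiricalMeasure₂]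
  rw [hfun]
  exact houter

end Meas

/-- **Registered sub-goal `stub_wciRecordMeasurable` (helper F of `stub_windowCovarianceIsotropy`): record-type window
functionals with measurable marks are jointly measurable in the window** (the Fubini measurability of the
Chebyshev-over-windows step). [folklore] -/
theorem stub_wciRecordMeasurable : ∀ {N : ℕ} {ε τ : ℝ} {γ : ℝ → Config (N + 1) (Fin 3) T3}, (collisionTimes (Torus.geometry (Fin 3)) ε γ ∩ Set.Icc 0 τ).Finite → ∀ (r : ℝ) {m : ℝ × T3 → ℝ → Fin (N + 1) → Fin (N + 1) → ℝ}, (∀ s i j, Measurable fun p => m p s i j) → Measurable fun p : ℝ × T3 => collisionPairSum (Torus.geometry (Fin 3)) ε γ (Set.Icc 0 τ) (fun s i j => btent r (s - p.1) * Summit.AtomisticToContinuum.HydrodynamicLimit.Theorems.LocalSecondLawNegative.cone r (γ s i).1 p.2 * m p s i j) :=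
  fun hfin r _ hm => measurable_recFun hfin r hm

end Summit.AtomisticToContinuum.HydrodynamicLimit.Theorems.ParityBandClosureWindowCovariance

end
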